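import Summits.Ventures.PercRepro.SevenThreeTripleWitness

/-!
# PercRepro — the `(7,3)` cell, (R6) part (a), continued: the point fibres and the three `D` bounds (night-3, gen 4)

Continuation of `SevenThreeTripleWitness.lean` (split for the 400-line file limit).  With `S = B ∪ X` (`B ⊆ G` of
rank `3`, `X` a `3`-set off `G`): the planes `P ≠ G` of `M|S` with `|P ∩ B| ≤ 1` are `cl(X)` (weight `1`, at most one)
and, per point `a ∈ B`, either `cl({a} ∪ X)` (weight `6`) or up to three `cl({a, w, w′})` (weight `1`) — `≤ 6` per
point, `≤ 3` when `ρ(S) = 6` (`point_fibre_le`).  Together with the line-fibre bound `triple_fibre_le`: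
`D(B ∪ X) ≤ 6^{|B| − 3} + 36Λ + 6|B| + 1` (`D_triple_le`), `≤ 6^{|B| − 3} + 7Λ + 6|B| + 1` when `ρ(B ∪ X) ≥ 5`
(`D_triple_le_rank_five`), `≤ 6^{|B| − 3} + 3Λ + 3|B| + 1` when `ρ(B ∪ X) = 6` (`D_triple_le_generic`) — the
denominators of mine-2 §26.1's `w₃⁼`, `w₃⁻`, `w₃`; `share_ge_of_D_le` turns a `D` bound into a share bound.
Axioms: standard.
-/

namespace PercRepro

namespace SevenThree

open Finset ThmH SixThree

variable {α : Type*} [DecidableEq α] {M : Matroid α} [M.Finite]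
/-- A point of a plane-subset `B` of a simple matroid has rank `1` (`B` has a second point). -/
theorem one_le_eRk_singleton (hs : Simple M) {B : Finset α} (hB : B ⊆ gr M) (h2 : 2 ≤ B.card) {a : α}
    (ha : a ∈ B) : (1 : ℕ∞) ≤ M.eRk (({a} : Finset α) : Set α) := by
  obtain ⟨f, hf, hfa⟩ : ∃ f ∈ B, f ≠ a := by
    by_contra h
    push Not at h
    have : B ⊆ {a} := fun y hy => Finset.mem_singleton.2 (h y hy)
    have := Finset.card_le_card this
    rw [Finset.card_singleton] at this
    omega
  have hpair : ({a, f} : Finset α) ⊆ gr M := by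
    intro y hy
    rw [Finset.mem_insert, Finset.mem_singleton] at hy
    rcases hy with rfl | rfl
    · exact hB ha
    · exact hB hf
  have h2' : (2 : ℕ∞) ≤ M.eRk (({a, f} : Finset α) : Set α) :=
    two_le_eRk_of_two_mem hs hpair (Finset.mem_insert_self a {f}) (Finset.mem_insert_of_mem (Finset.mem_singleton_self f))
      hfa.symm
  have hsplit : M.eRk (({a, f} : Finset α) : Set α) ≤ M.eRk (({a} : Finset α) : Set α) + 1 := by
    have := M.eRk_insert_le_add_one f (({a} : Finset α) : Set α)
    rw [← Finset.coe_insert] at this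
    rw [Finset.pair_comm]
    exact this
  have h3 : (2 : ℕ∞) ≤ M.eRk (({a} : Finset α) : Set α) + 1 := h2'.trans hsplit
  obtain ⟨k, hk, -⟩ := eRk_eq_nat M ({a} : Finset α)
  rw [hk] at h3 ⊢
  have h3' : 2 ≤ k + 1 := by exact_mod_cast h3
  exact_mod_cast (show 1 ≤ k by omega)

/-- **The point fibre.**  The planes `P ≠ G` with rank-`3` trace on `S = B ∪ X` and `P ∩ B = {a}` are the
`cl({a} ∪ (P ∩ X))` with `|P ∩ X| ≥ 2`: either the single plane through `{a} ∪ X` (trace `4`, weight `6`) or at most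
three planes of trace `{a, w, w′}` (weight `1` each).  They contribute `≤ 6`, and `≤ 3` when `ρ(B ∪ X) = 6` (then
`a ∉ cl(X)`). -/
theorem point_fibre_le (hs : Simple M) {G B : Finset α} (hG : G ∈ planes M) (hB : B ⊆ G)
    (hrB : M.eRk (B : Set α) = 3) {X : Finset α} (hXG : Disjoint X G) (hX3 : X.card = 3)
    {a : α} (ha : a ∈ B) (F : Finset (Finset α))
    (hF : ∀ P ∈ F, P ∈ planes M ∧ P ≠ G ∧ M.eRk (((B ∪ X) ∩ P : Finset α) : Set α) = 3 ∧ P ∩ B = {a}) :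
    ∑ P ∈ F, fRule M P (B ∪ X) ≤ 6 ∧
    (M.eRk ((B ∪ X : Finset α) : Set α) = 6 → ∑ P ∈ F, fRule M P (B ∪ X) ≤ 3) := by
  classical
  have hBg : B ⊆ gr M := hB.trans (mem_planes.1 hG).1
  have haX : a ∉ X := fun h => Finset.disjoint_left.1 hXG h (hB ha)
  have htrace : ∀ P ∈ F, (B ∪ X) ∩ P = insert a (P ∩ X) := by
    intro P hP
    rw [trace_union_eq, (hF P hP).2.2.2, Finset.insert_eq]
  have hcardtr : ∀ P ∈ F, ((B ∪ X) ∩ P).card = (P ∩ X).card + 1 := by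
    intro P hP
    rw [htrace P hP, Finset.card_insert_of_notMem (fun h => haX (Finset.mem_inter.1 h).2)]
  have hm2 : ∀ P ∈ F, 2 ≤ (P ∩ X).card := by
    intro P hP
    have h3 := three_le_card_of_eRk_eq_three (hF P hP).2.2.1
    rw [hcardtr P hP] at h3
    omega
  have hrule : ∀ P ∈ F, fRule M P (B ∪ X) = (6 : ℚ) ^ ((P ∩ X).card - 2) := by
    intro P hP
    unfold fRule
    rw [if_pos (hF P hP).2.2.1, hcardtr P hP]
    congr 1
  have hsubP : ∀ P ∈ F, insert a (P ∩ X) ⊆ P := by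
    intro P hP
    rw [← htrace P hP]
    exact Finset.inter_subset_right
  have hr3' : ∀ P ∈ F, M.eRk ((insert a (P ∩ X) : Finset α) : Set α) = 3 := by
    intro P hP
    rw [← htrace P hP]
    exact (hF P hP).2.2.1
  -- `P` is determined by its trace on `X`
  have hdet : ∀ P ∈ F, ∀ P' ∈ F, P ∩ X = P' ∩ X → P = P' := by
    intro P hP P' hP' h
    have hsub' : insert a (P ∩ X) ⊆ P' := by rw [h]; exact hsubP P' hP'
    exact planes_eq_of_subset (hF P hP).1 (hF P' hP').1 (hsubP P hP) hsub' (hr3' P hP)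
  have hm3 : ∀ P ∈ F, (P ∩ X).card ≤ 3 := fun P hP => by
    rw [← hX3]; exact Finset.card_le_card Finset.inter_subset_right
  by_cases hbig : ∃ P₀ ∈ F, X ⊆ P₀
  · obtain ⟨P₀, hP₀, hXP₀⟩ := hbig
    -- `F = {P₀}`
    have hF1 : F = {P₀} := by
      rw [Finset.eq_singleton_iff_unique_mem]
      refine ⟨hP₀, ?_⟩
      intro P hP
      have hsub' : insert a (P ∩ X) ⊆ P₀ := by
        apply Finset.insert_subset
        · have := hsubP P₀ hP₀
          exact this (Finset.mem_insert_self a _)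
        · exact Finset.inter_subset_right.trans hXP₀
      exact planes_eq_of_subset (hF P hP).1 (hF P₀ hP₀).1 (hsubP P hP) hsub' (hr3' P hP)
    have hP₀X : P₀ ∩ X = X := Finset.inter_eq_right.2 hXP₀
    refine ⟨?_, ?_⟩
    · rw [hF1, Finset.sum_singleton, hrule P₀ hP₀, hP₀X, hX3]
      norm_num
    · intro hr6
      exfalso
      -- `{a} ∪ X ⊆ P₀` has rank `≤ 3`, so `ρ(B ∪ X) ≤ 5` by submodularity against `B`
      have hsub' : insert a X ⊆ P₀ := Finset.insert_subset ((hsubP P₀ hP₀) (Finset.mem_insert_self a _)) hXP₀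
      have hrZ : M.eRk ((insert a X : Finset α) : Set α) ≤ 3 := by
        calc M.eRk ((insert a X : Finset α) : Set α) ≤ M.eRk (P₀ : Set α) := M.eRk_mono (Finset.coe_subset.2 hsub')
          _ = 3 := (mem_planes.1 (hF P₀ hP₀).1).2.2
      have hsm := M.eRk_inter_add_eRk_union_le (B : Set α) ((insert a X : Finset α) : Set α)
      rw [← Finset.coe_inter, ← Finset.coe_union, hrB] at hsm
      have hunion : B ∪ insert a X = B ∪ X := by
        ext y
        simp only [Finset.mem_union, Finset.mem_insert]
        constructor
        · rintro (hy | rfl | hy)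
          · exact Or.inl hy
          · exact Or.inl ha
          · exact Or.inr hy
        · rintro (hy | hy)
          · exact Or.inl hy
          · exact Or.inr (Or.inr hy)
      rw [hunion, hr6] at hsm
      have h1 : (1 : ℕ∞) ≤ M.eRk ((B ∩ insert a X : Finset α) : Set α) := by
        have hB2 : 2 ≤ B.card := by have := three_le_card_of_eRk_eq_three hrB; omega
        refine (one_le_eRk_singleton hs hBg hB2 ha).trans (M.eRk_mono (Finset.coe_subset.2 ?_))
        intro y hy
        rw [Finset.mem_singleton] at hy
        rw [hy, Finset.mem_inter]
        exact ⟨ha, Finset.mem_insert_self a X⟩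
      have h7 : (1 : ℕ∞) + 6 ≤ 3 + 3 :=
        (add_le_add h1 (le_refl _)).trans (hsm.trans (add_le_add (le_refl _) hrZ))
      exact absurd h7 (by decide)
  · push Not at hbig
    -- every plane of the fibre has trace `{a, w, w′}`: weight `1`, at most `C(3, 2) = 3` of them
    have hm : ∀ P ∈ F, (P ∩ X).card = 2 := by
      intro P hP
      have h2 := hm2 P hP
      have h3 := hm3 P hP
      by_contra hne
      have hc3 : (P ∩ X).card = 3 := by omega
      have hXP : X ⊆ P := by
        have hle : X.card ≤ (P ∩ X).card := by rw [hX3, hc3]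
        exact (Finset.eq_of_subset_of_card_le Finset.inter_subset_right hle).symm ▸ Finset.inter_subset_left
      exact hbig P hP hXP
    have hterm : ∀ P ∈ F, fRule M P (B ∪ X) = 1 := by
      intro P hP
      rw [hrule P hP, hm P hP, Nat.sub_self, pow_zero]
    have hinj : Set.InjOn (fun P => P ∩ X) (F : Set (Finset α)) := fun P hP P' hP' h => hdet P hP P' hP' h
    have hmaps : ∀ P ∈ F, P ∩ X ∈ X.powersetCard 2 := by
      intro P hP
      rw [Finset.mem_powersetCard]
      exact ⟨Finset.inter_subset_right, hm P hP⟩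
    have hcard : F.card ≤ 3 := by
      calc F.card = (F.image (fun P => P ∩ X)).card := (Finset.card_image_of_injOn hinj).symm
        _ ≤ (X.powersetCard 2).card := Finset.card_le_card (Finset.image_subset_iff.2 hmaps)
        _ = 3 := by rw [Finset.card_powersetCard, hX3]; decide
    have hsum : ∑ P ∈ F, fRule M P (B ∪ X) = (F.card : ℚ) := by
      rw [Finset.sum_congr rfl hterm, Finset.sum_const, nsmul_eq_mul, mul_one]
    have hc : (F.card : ℚ) ≤ 3 := by exact_mod_cast hcard
    rw [hsum]
    exact ⟨by linarith, fun _ => hc⟩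

/-- **The triple bound, parametrised by the fibre constants.**  With `S = B ∪ X`: if every line `L` of `M|B` receives
at most `c · 6^{|L ∩ B| − 2}` from the planes `P ≠ G` with `P ∩ B = L ∩ B`, and every point `a ∈ B` at most `d` from
the planes with `P ∩ B = {a}`, then `D(S) ≤ 6^{|B| − 3} + c · Λ(B) + (d · |B| + 1)` (the `+ 1` is the plane `cl(X)`). -/
theorem D_triple_le_of_bounds (hs : Simple M) {G B X : Finset α} (hG : G ∈ planes M) (hB : B ⊆ G)
    (hrB : M.eRk (B : Set α) = 3) (hXG : Disjoint X G) (hX3 : X.card = 3) (c d : ℚ)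
    (hfib : ∀ L ∈ linesOf M B, ∀ F : Finset (Finset α), (∀ P ∈ F, P ∈ planes M ∧ P ≠ G ∧
      M.eRk (((B ∪ X) ∩ P : Finset α) : Set α) = 3 ∧ P ∩ B = L ∩ B ∧ L ⊆ P) →
      ∑ P ∈ F, fRule M P (B ∪ X) ≤ c * (6 : ℚ) ^ ((L ∩ B).card - 2))
    (hpt : ∀ a ∈ B, ∀ F : Finset (Finset α), (∀ P ∈ F, P ∈ planes M ∧ P ≠ G ∧
      M.eRk (((B ∪ X) ∩ P : Finset α) : Set α) = 3 ∧ P ∩ B = {a}) →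
      ∑ P ∈ F, fRule M P (B ∪ X) ≤ d) :
    D M (B ∪ X) ≤ (6 : ℚ) ^ (B.card - 3) + c * Lam M B + (d * B.card + 1) := by
  classical
  have hBg : B ⊆ gr M := hB.trans (mem_planes.1 hG).1
  unfold D
  rw [← Finset.add_sum_erase (planes M) _ hG, fRule_eq_of_inter (union_inter_eq_of_disjoint hB hXG) hrB,
    sum_erase_eq_sum_planesOf, add_assoc]
  apply add_le_add (le_refl _)
  set S := B ∪ X with hS
  set A := planesOf M G S with hA
  have hAdata : ∀ P ∈ A, P ∈ planes M ∧ P ≠ G ∧ M.eRk ((S ∩ P : Finset α) : Set α) = 3 := by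
    intro P hP
    rw [hA, planesOf, Finset.mem_filter, Finset.mem_erase] at hP
    exact ⟨hP.1.2, hP.1.1, hP.2⟩
  rw [← Finset.sum_filter_add_sum_filter_not A (fun P => M.eRk ((P ∩ B : Finset α) : Set α) = 2)]
  apply add_le_add
  · -- the rank-2 traces, fibred over their lines
    set A₂ := A.filter (fun P => M.eRk ((P ∩ B : Finset α) : Set α) = 2) with hA₂
    have hA₂data : ∀ P ∈ A₂, P ∈ planes M ∧ P ≠ G ∧ M.eRk ((S ∩ P : Finset α) : Set α) = 3 ∧
        M.eRk ((P ∩ B : Finset α) : Set α) = 2 := by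
      intro P hP
      rw [hA₂, Finset.mem_filter] at hP
      exact ⟨(hAdata P hP.1).1, (hAdata P hP.1).2.1, (hAdata P hP.1).2.2, hP.2⟩
    have hmaps : ∀ P ∈ A₂, clF M (P ∩ B) ∈ linesOf M B := by
      intro P hP
      obtain ⟨hPpl, hne, -, h2⟩ := hA₂data P hP
      obtain ⟨hL, hLB, -, -⟩ := line_of_trace hG hPpl hB hrB h2
      unfold linesOf
      rw [Finset.mem_filter, hLB]
      exact ⟨hL, two_le_card_of_eRk_eq_two h2⟩
    rw [← Finset.sum_fiberwise_of_maps_to hmaps]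
    unfold Lam
    rw [Finset.mul_sum]
    apply Finset.sum_le_sum
    intro L hL
    apply hfib L hL
    intro P hP
    rw [Finset.mem_filter] at hP
    obtain ⟨hPpl, hne, hr3, h2⟩ := hA₂data P hP.1
    obtain ⟨-, hLB, -, hLP⟩ := line_of_trace hG hPpl hB hrB h2
    rw [hP.2] at hLB hLP
    exact ⟨hPpl, hne, hr3, hLB.symm, hLP⟩
  · -- the traces of rank `≤ 1`: `P ∩ B = ∅` (the plane `cl(X)`) or `P ∩ B = {a}` (the point fibres)
    set A₁ := A.filter (fun P => ¬ M.eRk ((P ∩ B : Finset α) : Set α) = 2) with hA₁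
    have hA₁data : ∀ P ∈ A₁, P ∈ planes M ∧ P ≠ G ∧ M.eRk ((S ∩ P : Finset α) : Set α) = 3 ∧
        (P ∩ B).card ≤ 1 := by
      intro P hP
      rw [hA₁, Finset.mem_filter] at hP
      obtain ⟨hPpl, hne, hr3⟩ := hAdata P hP.1
      refine ⟨hPpl, hne, hr3, ?_⟩
      apply card_le_one_of_eRk_le_one hs (Finset.inter_subset_right.trans hBg)
      have hle2 := eRk_inter_le_two hG hPpl hne hB
      obtain ⟨k, hk, -⟩ := eRk_eq_nat M (P ∩ B)
      rw [hk] at hle2 hP ⊢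
      have hk2 : k ≤ 2 := by exact_mod_cast hle2
      have hk2' : k ≠ 2 := fun h => hP.2 (by rw [h]; rfl)
      exact_mod_cast (show k ≤ 1 by omega)
    set T : Finset (Finset α) := insert ∅ (B.image (fun a => ({a} : Finset α))) with hT
    have hmaps : ∀ P ∈ A₁, P ∩ B ∈ T := by
      intro P hP
      obtain ⟨-, -, -, hcard1⟩ := hA₁data P hP
      rw [hT, Finset.mem_insert, Finset.mem_image]
      rcases (P ∩ B).eq_empty_or_nonempty with h | ⟨a, ha⟩
      · exact Or.inl h
      · right
        refine ⟨a, (Finset.mem_inter.1 ha).2, ?_⟩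
        symm
        exact Finset.eq_singleton_iff_unique_mem.2 ⟨ha, fun y hy => Finset.card_le_one.1 hcard1 y hy a ha⟩
    rw [← Finset.sum_fiberwise_of_maps_to hmaps]
    -- the fibre over `∅`: at most the plane `cl(X)`, of weight `1`
    have hempty : ∑ P ∈ A₁.filter (fun P => P ∩ B = ∅), fRule M P S ≤ 1 := by
      set F₀ := A₁.filter (fun P => P ∩ B = ∅) with hF₀
      have hF₀data : ∀ P ∈ F₀, P ∈ planes M ∧ S ∩ P = X := by
        intro P hP
        rw [hF₀, Finset.mem_filter] at hP
        obtain ⟨hPpl, -, hr3, -⟩ := hA₁data P hP.1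
        refine ⟨hPpl, ?_⟩
        have hsub : S ∩ P ⊆ X := by
          rw [hS, trace_union_eq, hP.2, Finset.empty_union]
          exact Finset.inter_subset_right
        have h3 := three_le_card_of_eRk_eq_three hr3
        exact Finset.eq_of_subset_of_card_le hsub (by rw [hX3]; exact h3)
      have hterm : ∀ P ∈ F₀, fRule M P S = 1 := by
        intro P hP
        have hP1 : P ∈ A₁ := (Finset.mem_filter.1 hP).1
        obtain ⟨-, -, hr3, -⟩ := hA₁data P hP1
        unfold fRule
        rw [if_pos hr3, (hF₀data P hP).2, hX3]
        norm_num
      have hsub : F₀ ⊆ {clF M X} := by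
        intro P hP
        obtain ⟨hPpl, hSP⟩ := hF₀data P hP
        rw [Finset.mem_singleton]
        apply Finset.coe_injective
        rw [coe_clF]
        have hXP : X ⊆ P := by rw [← hSP]; exact Finset.inter_subset_right
        have hr3' : M.eRk (X : Set α) = 3 := by
          rw [← hSP]
          exact (hA₁data P (Finset.mem_filter.1 hP).1).2.2.1
        exact (closure_eq_of_subset_plane hPpl hXP hr3').symm
      calc ∑ P ∈ F₀, fRule M P S = ∑ _P ∈ F₀, (1 : ℚ) := Finset.sum_congr rfl hterm
        _ = (F₀.card : ℚ) := by rw [Finset.sum_const, nsmul_eq_mul, mul_one]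
        _ ≤ 1 := by
            have := Finset.card_le_card hsub
            rw [Finset.card_singleton] at this
            exact_mod_cast this
    -- the fibre over `{a}`: the point-fibre hypothesis
    have hpoint : ∀ a ∈ B, ∑ P ∈ A₁.filter (fun P => P ∩ B = {a}), fRule M P S ≤ d := by
      intro a ha
      apply hpt a ha
      intro P hP
      rw [Finset.mem_filter] at hP
      obtain ⟨hPpl, hne, hr3, -⟩ := hA₁data P hP.1
      exact ⟨hPpl, hne, hr3, hP.2⟩
    have hnot : (∅ : Finset α) ∉ B.image (fun a => ({a} : Finset α)) := by
      rw [Finset.mem_image]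
      rintro ⟨a, -, h⟩
      exact Finset.singleton_ne_empty a h
    have hinj : Set.InjOn (fun a => ({a} : Finset α)) (B : Set α) := by
      intro a _ a' _ h
      exact Finset.singleton_injective h
    rw [hT, Finset.sum_insert hnot, Finset.sum_image hinj, add_comm]
    refine add_le_add ?_ hempty
    calc ∑ a ∈ B, ∑ P ∈ A₁.filter (fun P => P ∩ B = {a}), fRule M P S ≤ ∑ _a ∈ B, d :=
          Finset.sum_le_sum (fun a ha => hpoint a ha)
      _ = d * B.card := by rw [Finset.sum_const, nsmul_eq_mul, mul_comm]

/-- **The triple bound** (mine-2 §26.1, the denominator of `w₃⁼`): `D(B ∪ X) ≤ 6^{|B| − 3} + 36 · Λ(B) + (6|B| + 1)`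
for `B ⊆ G` of rank `3` and a `3`-set `X ⊆ E ∖ G`. -/
theorem D_triple_le (hs : Simple M) {G B X : Finset α} (hG : G ∈ planes M) (hB : B ⊆ G)
    (hrB : M.eRk (B : Set α) = 3) (hX : X ⊆ gr M) (hXG : Disjoint X G) (hX3 : X.card = 3) :
    D M (B ∪ X) ≤ (6 : ℚ) ^ (B.card - 3) + 36 * Lam M B + (6 * B.card + 1) := by
  apply D_triple_le_of_bounds hs hG hB hrB hXG hX3 36 6
  · intro L hL F hF
    have hLG := linesOf_subset_plane hs hG hB hrB hL
    have hL' : L ∈ lines M := (Finset.mem_filter.1 hL).1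
    have hLcard : 2 ≤ (L ∩ B).card := (Finset.mem_filter.1 hL).2
    exact (triple_fibre_le hs hG hB hrB hL' hLG hLcard hX hXG hX3 F hF).1
  · intro a ha F hF
    exact (point_fibre_le hs hG hB hrB hXG hX3 ha F hF).1

/-- **The triple bound at rank `≥ 5`** (the denominator of `w₃⁻`): if moreover `ρ(B ∪ X) ≥ 5`,
`D(B ∪ X) ≤ 6^{|B| − 3} + 7 · Λ(B) + (6|B| + 1)`. -/
theorem D_triple_le_rank_five (hs : Simple M) {G B X : Finset α} (hG : G ∈ planes M) (hB : B ⊆ G)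
    (hrB : M.eRk (B : Set α) = 3) (hX : X ⊆ gr M) (hXG : Disjoint X G) (hX3 : X.card = 3)
    (hr5 : (5 : ℕ∞) ≤ M.eRk ((B ∪ X : Finset α) : Set α)) :
    D M (B ∪ X) ≤ (6 : ℚ) ^ (B.card - 3) + 7 * Lam M B + (6 * B.card + 1) := by
  apply D_triple_le_of_bounds hs hG hB hrB hXG hX3 7 6
  · intro L hL F hF
    have hLG := linesOf_subset_plane hs hG hB hrB hL
    have hL' : L ∈ lines M := (Finset.mem_filter.1 hL).1
    have hLcard : 2 ≤ (L ∩ B).card := (Finset.mem_filter.1 hL).2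
    exact (triple_fibre_le hs hG hB hrB hL' hLG hLcard hX hXG hX3 F hF).2.1 hr5
  · intro a ha F hF
    exact (point_fibre_le hs hG hB hrB hXG hX3 ha F hF).1

/-- **The generic triple bound** (the denominator of `w₃`): if `ρ(B ∪ X) = 6`,
`D(B ∪ X) ≤ 6^{|B| − 3} + 3 · Λ(B) + (3|B| + 1)`. -/
theorem D_triple_le_generic (hs : Simple M) {G B X : Finset α} (hG : G ∈ planes M) (hB : B ⊆ G)
    (hrB : M.eRk (B : Set α) = 3) (hX : X ⊆ gr M) (hXG : Disjoint X G) (hX3 : X.card = 3)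
    (hr6 : M.eRk ((B ∪ X : Finset α) : Set α) = 6) :
    D M (B ∪ X) ≤ (6 : ℚ) ^ (B.card - 3) + 3 * Lam M B + (3 * B.card + 1) := by
  apply D_triple_le_of_bounds hs hG hB hrB hXG hX3 3 3
  · intro L hL F hF
    have hLG := linesOf_subset_plane hs hG hB hrB hL
    have hL' : L ∈ lines M := (Finset.mem_filter.1 hL).1
    have hLcard : 2 ≤ (L ∩ B).card := (Finset.mem_filter.1 hL).2
    exact (triple_fibre_le hs hG hB hrB hL' hLG hLcard hX hXG hX3 F hF).2.2 hr6
  · intro a ha F hF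
    exact (point_fibre_le hs hG hB hrB hXG hX3 ha F hF).2 hr6

/-- The share of `G` from a witness `B ∪ X` (`B = S ∩ G` of rank `3`) is at least `6^{|B| − 3} / D₀` for any
upper bound `D(B ∪ X) ≤ D₀`. -/
theorem share_ge_of_D_le {G B X : Finset α} (hG : G ∈ planes M) (hB : B ⊆ G) (hrB : M.eRk (B : Set α) = 3)
    (hXG : Disjoint X G) {D₀ : ℚ} (hD : D M (B ∪ X) ≤ D₀) :
    (6 : ℚ) ^ (B.card - 3) / D₀ ≤ fRule M G (B ∪ X) / D M (B ∪ X) := by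
  have hSG := union_inter_eq_of_disjoint hB hXG
  rw [fRule_eq_of_inter hSG hrB]
  obtain ⟨-, hDpos⟩ := D_pos hG hSG hrB
  exact div_le_div_of_nonneg_left (by positivity) hDpos hD

end SevenThree

end PercRepro
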